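import Mathlib
import Summits.AnomalousDissipation.AnomalousDissipation.Theorems.SoloBlindResolventReadout
import Summits.AnomalousDissipation.AnomalousDissipation.Theorems.SoloBlindNeumannSecondOrder

/-!
# Solo-blind kernel #283 — expansion at infinity: third-order Neumann and the `1/(ax+b)` expansions

ENGINE-L-SPEC §15(o.3): at `x → ∞` the read-out `k̂_y/c` expands as `a₁/x + a₂/x² + O(1/x³)`, the
model `A ξ(z+μ₀)` matches `a₁, a₂`, and the remainder `O(1/x³)` is square-integrable with an explicit
tail.  The ingredients typed here:
* `inverse_one_sub_eq_third`, `norm_inverse_one_sub_sub_sub_le`: `(1−T)⁻¹ = 1 + T + T² + T³(1−T)⁻¹`,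
  `‖(1−T)⁻¹ − 1 − T − T²‖ ≤ q³/(1−q)`;
* `inverse_add_expansion₃`: `‖(D+K)⁻¹ − (D⁻¹ − D⁻¹KD⁻¹ + D⁻¹KD⁻¹KD⁻¹)‖ ≤ q³/(1−q)·‖D⁻¹‖`;
* scalar expansions of the diagonal resolvent entries `1/β`, `β = a x + b`:
  `inv_linear_expand₁` (`1/(ax+b) = 1/(ax) − b/((ax)(ax+b))`),
  `inv_linear_expand₂` (`1/(ax+b) = 1/(ax) − b/(ax)² + b²/((ax)²(ax+b))`), with the norm bounds
  `norm_inv_linear_sub₁_le`, `norm_inv_linear_sub₂_le` under `‖ax+b‖ ≥ δ`.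
-/

namespace Summit.AnomalousDissipation.SoloBlind.ExpansionAtInfinity

open Summit.AnomalousDissipation.SoloBlind.ResolventReadout
open Summit.AnomalousDissipation.SoloBlind.NeumannSecondOrder

section Neumann

variable {A : Type*} [NormedRing A] [CompleteSpace A] [NormOneClass A]

omit [CompleteSpace A] [NormOneClass A] in
/-- `(1−T)⁻¹ = 1 + T + T² + T³ (1−T)⁻¹` when `1 − T` is a unit. -/
theorem inverse_one_sub_eq_third {T : A} (h : IsUnit (1 - T)) :
    Ring.inverse (1 - T) = 1 + T + T * T + T * T * T * Ring.inverse (1 - T) := by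
  have h2 := inverse_one_sub_eq_second h
  have h1 := inverse_one_sub_eq_first h
  conv_lhs => rw [h2]
  conv_lhs => arg 2; rw [h1]
  rw [mul_add, mul_one, ← mul_assoc]
  abel

/-- **Third-order remainder**: `‖(1−T)⁻¹ − 1 − T − T²‖ ≤ q³/(1−q)`. -/
theorem norm_inverse_one_sub_sub_sub_le {T : A} {q : ℝ} (hT : ‖T‖ ≤ q) (hq : q < 1) :
    ‖Ring.inverse (1 - T) - 1 - T - T * T‖ ≤ q ^ 3 / (1 - q) := by
  have hu : IsUnit (1 - T) := isUnit_of_norm_lt_one (lt_of_le_of_lt hT hq)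
  have hR := norm_inverse_one_sub_le hT hq
  have hq0 : 0 ≤ q := le_trans (norm_nonneg _) hT
  have h1q : 0 < 1 - q := by linarith
  have he : Ring.inverse (1 - T) - 1 - T - T * T = T * T * T * Ring.inverse (1 - T) := by
    conv_lhs => rw [inverse_one_sub_eq_third hu]
    abel
  rw [he]
  have hTT : ‖T * T‖ ≤ q * q := le_trans (norm_mul_le _ _) (mul_le_mul hT hT (norm_nonneg _) hq0)
  have hTTT : ‖T * T * T‖ ≤ q * q * q :=
    le_trans (norm_mul_le _ _) (mul_le_mul hTT hT (norm_nonneg _) (mul_nonneg hq0 hq0))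
  calc ‖T * T * T * Ring.inverse (1 - T)‖ ≤ ‖T * T * T‖ * ‖Ring.inverse (1 - T)‖ := norm_mul_le _ _
    _ ≤ q * q * q * (1 - q)⁻¹ :=
        mul_le_mul hTTT hR (norm_nonneg _) (mul_nonneg (mul_nonneg hq0 hq0) hq0)
    _ = q ^ 3 / (1 - q) := by rw [div_eq_mul_inv]; ring

/-- **Third-order expansion of `(D+K)⁻¹`**: with `‖D⁻¹K‖ ≤ q < 1`,
`‖(D+K)⁻¹ − (D⁻¹ − D⁻¹KD⁻¹ + D⁻¹KD⁻¹KD⁻¹)‖ ≤ q³/(1−q)·‖D⁻¹‖`. -/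
theorem inverse_add_expansion₃ {D K : A} (hD : IsUnit D) {q : ℝ}
    (hT : ‖Ring.inverse D * K‖ ≤ q) (hq : q < 1) :
    IsUnit (D + K) ∧
      ‖Ring.inverse (D + K) - (Ring.inverse D - Ring.inverse D * K * Ring.inverse D
          + Ring.inverse D * K * Ring.inverse D * K * Ring.inverse D)‖
        ≤ q ^ 3 / (1 - q) * ‖Ring.inverse D‖ := by
  obtain ⟨u, rfl⟩ := hD
  set Di : A := Ring.inverse (↑u : A) with hDi
  have hDi' : Di = ↑u⁻¹ := by rw [hDi, Ring.inverse_unit]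
  set T : A := -(Di * K) with hTdef
  have hTn : ‖T‖ ≤ q := by rw [hTdef, norm_neg]; exact hT
  have hu1 : IsUnit (1 - T) := isUnit_of_norm_lt_one (lt_of_le_of_lt hTn hq)
  have hfac : (↑u : A) + K = ↑u * (1 - T) := by
    rw [hTdef, sub_neg_eq_add, mul_add, mul_one, ← mul_assoc, hDi', Units.mul_inv, one_mul]
  obtain ⟨w, hw⟩ := hu1
  have hunit : IsUnit ((↑u : A) + K) := by rw [hfac, ← hw]; exact (u * w).isUnit
  refine ⟨hunit, ?_⟩
  have hinv : Ring.inverse ((↑u : A) + K) = Ring.inverse (1 - T) * Di := by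
    rw [hfac, ← hw, show (↑u : A) * ↑w = ↑(u * w) from rfl, Ring.inverse_unit, mul_inv_rev,
      Units.val_mul, hDi', Ring.inverse_unit]
  have hexp : Ring.inverse ((↑u : A) + K) - (Di - Di * K * Di + Di * K * Di * K * Di)
      = (Ring.inverse (1 - T) - 1 - T - T * T) * Di := by
    rw [hinv, hTdef]
    simp only [sub_mul, one_mul, neg_mul, mul_neg, neg_neg, mul_assoc]
    abel
  rw [hexp]
  calc ‖(Ring.inverse (1 - T) - 1 - T - T * T) * Di‖
      ≤ ‖Ring.inverse (1 - T) - 1 - T - T * T‖ * ‖Di‖ := norm_mul_le _ _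
    _ ≤ q ^ 3 / (1 - q) * ‖Di‖ :=
        mul_le_mul_of_nonneg_right (norm_inverse_one_sub_sub_sub_le hTn hq) (norm_nonneg _)

end Neumann

section Scalar

/-- `1/(ax+b) = 1/(ax) − b/((ax)(ax+b))` (`ax ≠ 0`, `ax + b ≠ 0`). -/
theorem inv_linear_expand₁ {w b : ℂ} (hw : w ≠ 0) (hwb : w + b ≠ 0) :
    (w + b)⁻¹ = w⁻¹ - b / (w * (w + b)) := by
  field_simp
  ring

/-- `1/(ax+b) = 1/(ax) − b/(ax)² + b²/((ax)²(ax+b))`. -/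
theorem inv_linear_expand₂ {w b : ℂ} (hw : w ≠ 0) (hwb : w + b ≠ 0) :
    (w + b)⁻¹ = w⁻¹ - b / w ^ 2 + b ^ 2 / (w ^ 2 * (w + b)) := by
  field_simp
  ring

/-- First-order remainder: `‖(w+b)⁻¹ − w⁻¹‖ ≤ ‖b‖/(‖w‖ δ)` when `‖w + b‖ ≥ δ > 0`. -/
theorem norm_inv_linear_sub₁_le {w b : ℂ} {δ : ℝ} (hδ : 0 < δ) (hw : w ≠ 0) (hwb : δ ≤ ‖w + b‖) :
    ‖(w + b)⁻¹ - w⁻¹‖ ≤ ‖b‖ / (‖w‖ * δ) := by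
  have hwb0 : w + b ≠ 0 := fun h => by rw [h, norm_zero] at hwb; linarith
  rw [inv_linear_expand₁ hw hwb0, sub_sub_cancel_left, norm_neg, norm_div, norm_mul]
  have hw0 : 0 < ‖w‖ := norm_pos_iff.2 hw
  exact div_le_div_of_nonneg_left (norm_nonneg _) (mul_pos hw0 hδ)
    (mul_le_mul_of_nonneg_left hwb hw0.le)

/-- Second-order remainder: `‖(w+b)⁻¹ − w⁻¹ + b/w²‖ ≤ ‖b‖²/(‖w‖² δ)` when `‖w + b‖ ≥ δ > 0`. -/
theorem norm_inv_linear_sub₂_le {w b : ℂ} {δ : ℝ} (hδ : 0 < δ) (hw : w ≠ 0) (hwb : δ ≤ ‖w + b‖) :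
    ‖(w + b)⁻¹ - w⁻¹ + b / w ^ 2‖ ≤ ‖b‖ ^ 2 / (‖w‖ ^ 2 * δ) := by
  have hwb0 : w + b ≠ 0 := fun h => by rw [h, norm_zero] at hwb; linarith
  have he : (w + b)⁻¹ - w⁻¹ + b / w ^ 2 = b ^ 2 / (w ^ 2 * (w + b)) := by
    rw [inv_linear_expand₂ hw hwb0]; ring
  rw [he, norm_div, norm_mul, norm_pow, norm_pow]
  have hw0 : 0 < ‖w‖ := norm_pos_iff.2 hw
  exact div_le_div_of_nonneg_left (sq_nonneg _) (mul_pos (pow_pos hw0 2) hδ)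
    (mul_le_mul_of_nonneg_left hwb (pow_pos hw0 2).le)

/-- Product of two diagonal entries: `1/((w+b)(w+c)) = 1/w² + r` with
`‖r‖ ≤ ‖b‖/(‖w‖δ)·‖w‖⁻¹ + ‖w+b‖⁻¹·‖c‖/(‖w‖δ)` (`≤ (‖b‖ + ‖c‖)/(‖w‖² δ)` once also `‖w+b‖ ≥ ‖w‖`)
when `‖w+b‖, ‖w+c‖ ≥ δ > 0`. -/
theorem norm_inv_prod_sub_le {w b c : ℂ} {δ : ℝ} (hδ : 0 < δ) (hw : w ≠ 0)
    (hwb : δ ≤ ‖w + b‖) (hwc : δ ≤ ‖w + c‖) :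
    ‖(w + b)⁻¹ * (w + c)⁻¹ - w⁻¹ * w⁻¹‖
      ≤ ‖b‖ / (‖w‖ * δ) * ‖w‖⁻¹ + ‖w + b‖⁻¹ * (‖c‖ / (‖w‖ * δ)) := by
  have h1 := norm_inv_linear_sub₁_le hδ hw hwb
  have h2 := norm_inv_linear_sub₁_le hδ hw hwc
  have he : (w + b)⁻¹ * (w + c)⁻¹ - w⁻¹ * w⁻¹
      = ((w + b)⁻¹ - w⁻¹) * w⁻¹ + (w + b)⁻¹ * ((w + c)⁻¹ - w⁻¹) := by ring
  rw [he]
  calc ‖((w + b)⁻¹ - w⁻¹) * w⁻¹ + (w + b)⁻¹ * ((w + c)⁻¹ - w⁻¹)‖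
      ≤ ‖((w + b)⁻¹ - w⁻¹) * w⁻¹‖ + ‖(w + b)⁻¹ * ((w + c)⁻¹ - w⁻¹)‖ := norm_add_le _ _
    _ = ‖(w + b)⁻¹ - w⁻¹‖ * ‖w‖⁻¹ + ‖w + b‖⁻¹ * ‖(w + c)⁻¹ - w⁻¹‖ := by
        rw [norm_mul, norm_mul, norm_inv, norm_inv]
    _ ≤ ‖b‖ / (‖w‖ * δ) * ‖w‖⁻¹ + ‖w + b‖⁻¹ * (‖c‖ / (‖w‖ * δ)) := by
        gcongr

end Scalar

end Summit.AnomalousDissipation.SoloBlind.ExpansionAtInfinity
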